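import Summits.AnomalousDissipation.AnomalousDissipation.Theorems.TwodBoundedEnergyZeroMomentum.Negative.SteadyShellIdentity
import Literature.Analysis.FluidPDE.LerayHopfTimeSliceTorus

/-!
# Steady witnesses of the crux `TwoAndHalfD.TwodBoundedEnergyZeroMomentum` form a cone
(negative-side toolbox, cdisprove seat `refuter-cdisprove-stmt-AnomalousDissipation-10786-g2-0`, gen 2)

The amplitude–time scaling of the Navier–Stokes equations on a FIXED torus,
`(ν, g, v, p) ↦ (aν, a²g, a v, a² p)`, maps steady states to steady states
(`steady_smul`: `(av·∇)(av) = a²(v·∇)v`, `aν Δ(av) = a² νΔv`, `∇(a²p) = a²∇p`). Consequently the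
set of forces admitting a bounded zero-mean steady branch along vanishing viscosity — the transfer
target `BoundedSteadyBranch` of the round-1 crux ideas — is a CONE: if `g` is such a force then so
is `a²g` for every `a > 0` (`boundedSteadyBranch_smul`), with energies scaled by `a²` and
viscosities by `a`. For provers: the amplitude of `g` is never the issue, only its SHAPE (and, by
`exists_mode_two_le_of_witness`, the shape must reach a shell `|k|² ≥ 2`); for the refuter: any
obstruction to steady witnesses must be invariant under this scaling (the first-shell floor
`‖g‖₂²/(16π⁴ν²)` is: `a⁴/a² = a²` matches the energy scaling).

No new definitions.
-/

noncomputable section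

open MeasureTheory Set Filter Topology UnitAddTorus
open scoped ENNReal NNReal InnerProductSpace

namespace Summit.AnomalousDissipation.AnomalousDissipation.Theorems.TwodBoundedEnergyZeroMomentum.Negative

open Literature.Analysis.FunctionSpaces Literature.Analysis.FunctionSpaces.Torus
open Literature.Analysis.FluidPDE Literature.Analysis.FluidPDE.Torus

section Scaling

variable {d : Type*} [Fintype d] [DecidableEq d]
variable {ν : ℝ} {g v : UnitAddTorus d → EuclideanSpace ℝ d} {p : UnitAddTorus d → ℝ}

omit [DecidableEq d] in
/-- The gradient is linear in the scalar: `∇(c θ) = c ∇θ` for `C¹` `θ`. [folklore] -/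
theorem gradient_fun_const_smul {θ : UnitAddTorus d → ℝ} (hθ : Torus.IsContDiff 1 θ) (c : ℝ)
    (x : UnitAddTorus d) : gradient (fun y => c • θ y) x = c • gradient θ x := by
  refine ext_inner_right ℝ fun w => ?_
  rw [Torus.inner_gradient_left, show (fun y => c • θ y) = c • θ from rfl,
    Torus.fderiv_const_smul hθ, real_inner_smul_left, Torus.inner_gradient_left]
  rfl

omit [Fintype d] [DecidableEq d] in
/-- The convective derivative is linear in the advecting field: `((c u)·∇)w = c (u·∇)w`. [folklore] -/
theorem convect_fun_const_smul_left (c : ℝ) (u : UnitAddTorus d → EuclideanSpace ℝ d)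
    {F : Type*} [NormedAddCommGroup F] [NormedSpace ℝ F] (w : UnitAddTorus d → F)
    (x : UnitAddTorus d) : convect (fun y => c • u y) w x = c • convect u w x := by
  simp only [Torus.convect, map_smul]

/-- **Amplitude scaling of steady states**: if `(v, p)` is a smooth steady state of `NS_ν(g)`,
then `(a v, a² p)` is a smooth steady state of `NS_{aν}(a² g)`, for every real `a`
(`(av·∇)(av) = a²(v·∇)v`, `aνΔ(av) = a²νΔv`, `∇(a²p) = a²∇p`). [folklore] -/
theorem steady_smul (hv : IsSteadyNSState ν g v p) (a : ℝ) :
    IsSteadyNSState (a * ν) (fun x => a ^ 2 • g x) (fun x => a • v x) (fun x => a ^ 2 • p x) where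
  smooth_velocity := (isSmoothSpaceTimeOn_const (steady_isSmooth hv) univ).const_smul a
  smooth_pressure := (isSmoothSpaceTimeOn_const (steady_isSmooth_pressure hv) univ).const_smul (a ^ 2)
  momentum := fun t _ x => by
    have hvs := steady_isSmooth hv
    have hps := steady_isSmooth_pressure hv
    rw [torus_timeDerivWithin_const, zero_add]
    have h := steady_convect_eq hv x
    have hconv : convect (fun y => a • v y) (fun y => a • v y) x = a ^ 2 • convect v v x := by
      rw [convect_fun_const_smul_left, convect_const_smul v (hvs.isContDiff (by simp)) a x, smul_smul,
        pow_two]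
    have hlap : laplacian (fun y => a • v y) x = a • laplacian v x := laplacian_const_smul hvs a x
    have hgrad : gradient (fun y => a ^ 2 • p y) x = a ^ 2 • gradient p x :=
      gradient_fun_const_smul (hps.isContDiff (by simp)) (a ^ 2) x
    rw [hconv, hlap, hgrad, h, smul_smul]
    show a ^ 2 • (ν • laplacian v x - gradient p x + g x) =
      (a * ν * a) • laplacian v x - a ^ 2 • gradient p x + a ^ 2 • g x
    rw [smul_add, smul_sub, smul_smul]
    congr 2
    ring
  divFree := fun t _ x => by
    show divergence (fun y => a • v y) x = 0
    rw [divergence_fun_const_smul, steady_isDivFree hv x, mul_zero]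

end Scaling

section Cone

/-- **The bounded-steady-branch forces form a cone.** If a force `g` on `𝕋²` admits zero-mean
smooth steady states `v_j` of `NS_{ν_j}(g)` along `ν_j → 0⁺` with energies `≤ E`, then for every
`a > 0` the force `a² g` admits the zero-mean steady states `a v_j` of `NS_{aν_j}(a²g)`
(`aν_j → 0⁺`) with energies `≤ a² E`. [folklore] -/
theorem boundedSteadyBranch_smul {g : UnitAddTorus (Fin 2) → EuclideanSpace ℝ (Fin 2)} {a : ℝ}
    (ha : 0 < a) {ν : ℕ → ℝ} {v : ℕ → UnitAddTorus (Fin 2) → EuclideanSpace ℝ (Fin 2)}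
    {p : ℕ → UnitAddTorus (Fin 2) → ℝ} (hν : ∀ j, 0 < ν j) (hν0 : Tendsto ν atTop (𝓝 0))
    (hst : ∀ j, IsSteadyNSState (ν j) g (v j) (p j)) (hvm : ∀ j, HasZeroMean (v j)) {E : ℝ}
    (hE : ∀ j, ∫ x, ‖v j x‖ ^ 2 ≤ E) :
    ∃ (ν' : ℕ → ℝ) (v' : ℕ → UnitAddTorus (Fin 2) → EuclideanSpace ℝ (Fin 2))
      (p' : ℕ → UnitAddTorus (Fin 2) → ℝ),
      (∀ j, 0 < ν' j) ∧ Tendsto ν' atTop (𝓝 0) ∧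
      (∀ j, IsSteadyNSState (ν' j) (fun x => a ^ 2 • g x) (v' j) (p' j)) ∧
      (∀ j, HasZeroMean (v' j)) ∧ ∀ j, ∫ x, ‖v' j x‖ ^ 2 ≤ a ^ 2 * E := by
  refine ⟨fun j => a * ν j, fun j x => a • v j x, fun j x => a ^ 2 • p j x,
    fun j => mul_pos ha (hν j), ?_, fun j => steady_smul (hst j) a, fun j => ?_, fun j => ?_⟩
  · simpa using hν0.const_mul a
  · show ∫ x, a • v j x = 0
    rw [integral_smul, show (∫ x, v j x) = 0 from hvm j, smul_zero]
  · have h1 : ∫ x, ‖a • v j x‖ ^ 2 = a ^ 2 * ∫ x, ‖v j x‖ ^ 2 := by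
      rw [← integral_const_mul]
      refine integral_congr_ae (ae_of_all _ fun x => ?_)
      show ‖a • v j x‖ ^ 2 = a ^ 2 * ‖v j x‖ ^ 2
      rw [norm_smul, mul_pow, Real.norm_eq_abs, sq_abs]
    rw [h1]
    exact mul_le_mul_of_nonneg_left (hE j) (sq_nonneg a)

end Cone

end Summit.AnomalousDissipation.AnomalousDissipation.Theorems.TwodBoundedEnergyZeroMomentum.Negative

end
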